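import Literature.Topology.PlanarFoliations.WalkWinding
import Literature.Topology.PlanarFoliations.WalkVanishing
import Literature.Topology.PlanarFoliations.CircleDegreeOne
import HarnessLib

/-!
# The image loop of a closed walk hugged by essential compact leaves is essential

Topic: Topology / PlanarFoliations, sequel to `WalkWinding.lean` (no open leaf spirals onto a null
closed walk: the band of tracked leaves, its winding numbers, the jump across a straight piece),
`WalkNullTransport.lean` (null transport along a closed walk), `WalkVanishing.lean`,
`CircleDegreeOne.lean`. **Let a closed walk of the separatrix graph turn to the side `s`, with a
straight piece on its trace, and let compact leaves `K n`, none image-null, cross the star vertical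
of its first prong point on the side `s` at levels accumulating to the base level. Then the image
loop of the walk (the base horizontal of its walk fence, in the leaf topology of `T`) is not
null-homotopic** (`walkBase_not_null`). For if it were: by null transport the nearby closed levels
of the walk fence are null levels and the tracked planar leaves return (`walkFence_χ_eq_χ₀_of_null`,
`IsFenceOn.exists_forall_nullLevel_base`); at a crossing level the tracked loop `c` lies in the
compact leaf `K n` and its image `g ∘ ι ∘ c`, the horizontal of the fence, is null-homotopic; `c`
is homotopic to the `d`-th power of the simple leaf loop `γ` of `K n` (`exists_homotopic_loopPow`),
so the winding numbers of `ι ∘ c` about the two test points of the straight piece are `d` times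
those of `ι ∘ γ` (`wind_pathLoop_sub_eq_mul`), while they are those of the trace (the band
deformation, `wind_walkPlaneBand_eq`), which differ by `±1` (`StraightPiece.wind_sub_wind`): so
`d = ±1`, `c ≃ γ^{±1}`, the image of `γ` is null-homotopic and `K n` is image-null — a
contradiction. The test points are chosen at generic heights off all the leaves `K n` at once
(`exists_heights_not_mem_leafHeights_seq`).

## References

* C. Camacho, A. Lins Neto, *Geometric Theory of Foliations*, Birkhäuser (1985), Ch. VII §2
  [CamachoLinsNeto1985].
-/

noncomputable section

open Set Filter Function Metric unitInterval
open _root_.Topology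
open Literature.Topology.FourManifolds Literature.Topology.FourManifolds.Foliation Literature.Topology.PlaneTopology

namespace Literature.Topology.PlanarFoliations

variable {X : Type*} [TopologicalSpace X] [T2Space X] [SecondCountableTopology X] [Nonempty X] {F : Foliation ℝ X} {ι : X → ℂ}

omit [T2Space X] [Nonempty X] in
/-- **Generic chart heights off countably many leaves**: `ρ ∈ (0, r)` with `h₀ ± ρ` not leaf
heights, in the chart `e`, of any of the leaves of the points `K n`. [folklore] -/
theorem exists_heights_not_mem_leafHeights_seq {e : OpenPartialHomeomorph X (ℝ × ℝ)} (he : e ∈ F.atlas)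
    (K : ℕ → X) (h₀ : ℝ) {r : ℝ} (hr : 0 < r) :
    ∃ ρ ∈ Ioo 0 r, ∀ n, h₀ + ρ ∉ F.leafHeights e (K n) ∧ h₀ - ρ ∉ F.leafHeights e (K n) := by
  set S := ⋃ n, F.leafHeights e (K n) with hS
  have hcount : S.Countable := countable_iUnion fun n ↦ F.countable_leafHeights he (K n)
  set C : Set ℝ := (fun t ↦ t - h₀) '' S ∪ (fun t ↦ h₀ - t) '' S with hC
  have hC' : C.Countable := (hcount.image _).union (hcount.image _)
  have hdense : Dense Cᶜ := hC'.dense_compl ℝ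
  obtain ⟨ρ, hρC, hρ⟩ := hdense.exists_mem_open isOpen_Ioo (nonempty_Ioo.2 hr)
  refine ⟨ρ, hρ, fun n ↦ ⟨fun h ↦ hρC (Or.inl ⟨h₀ + ρ, mem_iUnion.2 ⟨n, h⟩, by ring⟩),
    fun h ↦ hρC (Or.inr ⟨h₀ - ρ, mem_iUnion.2 ⟨n, h⟩, by ring⟩)⟩⟩

namespace CircleLoops

variable {Y : Type*} [TopologicalSpace Y] [T2Space Y] {Z : Type*} [TopologicalSpace Z] {β : ℝ → Y}

/-- **A loop whose image winds `±1` more about `p₁` than about `p₂` is homotopic to the simple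
loop `β` or to its reverse** (no hypothesis on the winding of the image of `β`: if the loop is
`β^d`, then `d` divides `±1`). [folklore] -/
theorem homotopic_loop_or_symm_of_wind' (hc : Continuous β) (hp : Periodic β 1) (hinj : InjOn β (Ico 0 1))
    (hsurj : range β = univ) {Φ : Y → ℂ} (hΦ : Continuous Φ) (h : Path (β 0) (β 0)) {p₁ p₂ : ℂ}
    (hq₁ : ∀ y, Φ y ≠ p₁) (hq₂ : ∀ y, Φ y ≠ p₂)
    (hjump : wind (fun t ↦ pathLoop Φ h t - p₁) - wind (fun t ↦ pathLoop Φ h t - p₂) = 1 ∨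
      wind (fun t ↦ pathLoop Φ h t - p₁) - wind (fun t ↦ pathLoop Φ h t - p₂) = -1) :
    h.Homotopic (loop hc hp) ∨ h.Homotopic (loop hc hp).symm := by
  obtain ⟨d, hd⟩ := exists_homotopic_loopPow hc hp hinj hsurj h
  rw [wind_pathLoop_sub_eq_mul hc hp hΦ hd hq₁, wind_pathLoop_sub_eq_mul hc hp hΦ hd hq₂, ← mul_sub] at hjump
  have hd1 : d = 1 ∨ d = -1 := by
    rcases hjump with hj | hj
    · exact Int.eq_one_or_neg_one_of_mul_eq_one hj
    · exact Int.eq_one_or_neg_one_of_mul_eq_one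
        (v := -(wind (fun t ↦ Φ (β t) - p₁) - wind (fun t ↦ Φ (β t) - p₂))) (by rw [mul_neg, hj, neg_neg])
  rcases hd1 with h1 | h1
  · left; rw [h1, loopPow_one] at hd; exact hd
  · right; rw [h1, loopPow_neg, loopPow_one] at hd; exact hd

end CircleLoops

variable {B : Type*} [NormedAddCommGroup B] [NormedSpace ℝ B] [LocallyConnectedSpace B] [Nonempty B] {M : Type*} [TopologicalSpace M]
  {T : Foliation B M} {g : ℂ → M}

namespace StarData

variable {D : StarData F ι T g} {hι : IsOpenEmbedding ι}
variable (ho : F.IsTransverselyOriented) {J : ℕ → D.WalkJunction hι}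
  {ℓ : ∀ k, Path (J k).Kout.base (J (k + 1)).Kin.base} (hℓ : ∀ k, Continuous (toLeafSpace ∘ ℓ k : I → F.LeafSpace))
  {s : ℝ} (hs : s = 1 ∨ s = -1) (hturn : ∀ k, (J k).jout = (J k).turn s)

include ho hℓ hs hturn in
/-- **The image loop of a closed walk hugged on its turning side by essential compact leaves is
essential.** See the module docstring. [cite: CamachoLinsNeto1985, Ch. VII §2] -/
theorem walkBase_not_null (hbi : IsBiOriented F) {m : ℕ} (hper : J m = J 0) {e : OpenPartialHomeomorph X (ℝ × ℝ)}
    (he : e ∈ F.atlas) {e' : OpenPartialHomeomorph X (ℝ × ℝ)} (he' : e'.target = univ) (P : StraightPiece ι e' (traceLoop J ℓ m))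
    {a : ℝ} (hP : ∀ ρ, P.pt ρ = ι (e.symm (a, P.h₀ + ρ)))
    {K : ℕ → X} (hK : ∀ n, IsCompact (F.leaf (K n))) (hess : ∀ n, ¬ ImageNull D.foliated (K n))
    (hcross : ∀ ε > 0, ∃ N, ∀ n ≥ N, ∃ h, 0 < s * h ∧ |h| < ε ∧
      (D.star _ (J 0).hv).horiz hι (J 0).jin h (J 0).β ∈ F.leaf (K n)) :
    ¬ ∃ (p : T.LeafSpace) (L : Path p p), (∀ θ, L θ = toLeafSpace (D.walkBase J ℓ m θ)) ∧ L.Homotopic (Path.refl p) := by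
  intro hnull
  set W := D.walkFence ho hℓ hs hturn m with hW
  set Ψ := walkPlaneBand ho hℓ hs hturn m with hΨ
  set ω := walkPlaneBase J ℓ m with hω
  -- generic test heights, off every leaf `K n`
  obtain ⟨ρ, hρ, hρoff⟩ := exists_heights_not_mem_leafHeights_seq (F := F) he K P.h₀ P.hr
  have hp : ∀ lv : ℝ, lv = ρ ∨ lv = -ρ → ∀ n, ∀ z ∈ F.leaf (K n), ι z ≠ P.pt lv := by
    rintro lv (rfl | rfl) n
    · rw [hP]; exact image_ne_of_not_mem_leafHeights he (hρoff n).1 hι.injective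
    · rw [hP, ← sub_eq_add_neg]; exact image_ne_of_not_mem_leafHeights he (hρoff n).2 hι.injective
  -- the test points are off the trace, with a margin
  have hωc : Continuous ω := continuous_walkPlaneBase ho hℓ hs hturn m
  have hne : ∀ lv : ℝ, lv = ρ ∨ lv = -ρ → ∀ θ : I, ω θ ≠ P.pt lv := fun lv hlv θ ↦ by
    rw [hω, ← traceLoop_coe hper θ]
    refine P.ne_pt hι.injective he' (periodic_traceLoop m) ?_ ?_ θ
    · rcases hlv with rfl | rfl <;> [exact hρ.1.ne'; exact neg_ne_zero.2 hρ.1.ne']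
    · rcases hlv with rfl | rfl <;> simp [abs_of_pos hρ.1, hρ.2]
  have hKc : IsCompact (range ω) := isCompact_range hωc
  have hdpos : ∀ lv : ℝ, lv = ρ ∨ lv = -ρ → 0 < infDist (P.pt lv) (range ω) := fun lv hlv ↦
    (hKc.isClosed.notMem_iff_infDist_pos (range_nonempty ω)).1 (by rintro ⟨θ, hθ⟩; exact hne lv hlv θ hθ)
  set d := min (infDist (P.pt ρ) (range ω)) (infDist (P.pt (-ρ)) (range ω)) with hd
  have hd0 : 0 < d := lt_min (hdpos ρ (Or.inl rfl)) (hdpos (-ρ) (Or.inr rfl))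
  have hfar : ∀ lv : ℝ, lv = ρ ∨ lv = -ρ → ∀ {z : ℂ} {θ : I}, dist z (ω θ) < d → z ≠ P.pt lv := by
    intro lv hlv z θ hz heq
    rw [heq] at hz
    have h1 : d ≤ infDist (P.pt lv) (range ω) := by
      rcases hlv with rfl | rfl <;> [exact min_le_left _ _; exact min_le_right _ _]
    have h2 : infDist (P.pt lv) (range ω) ≤ dist (P.pt lv) (ω θ) := infDist_le_dist_of_mem ⟨θ, rfl⟩
    linarith
  -- the levels return, the band converges, and nearby closed levels are null levels
  obtain ⟨η₁, hη₁, hη₁ε, hχ⟩ := walkFence_χ_eq_χ₀_of_null ho J ℓ hℓ hs hturn hper hnull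
  obtain ⟨η₂, hη₂, hη₂sub⟩ := Metric.eventually_nhds_iff.1 (eventually_forall_dist_lt ho hℓ hs hturn m hd0)
  have hstart := D.walkFence_start ho hℓ hs hturn m
  have hτ₀I : (J 0).τ₀ ∈ Ioo ((J 0).τ₀ - W.ε) ((J 0).τ₀ + W.ε) := ⟨by linarith [W.ε_pos], by linarith [W.ε_pos]⟩
  have hcl₀ : W.Φ 1 (J 0).τ₀ = W.Φ 0 (J 0).τ₀ := by
    rw [W.Φ_one _ hτ₀I, W.Φ_zero _ hτ₀I, W.χ_apply, (J 0).χ₀_τ₀, hper]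
  have hnl₀ : W.isFenceOn.NullLevel (J 0).τ₀ := by
    obtain ⟨p, L, hL, hLnull⟩ := hnull
    refine ⟨hτ₀I, hcl₀, ?_⟩
    exact (Path.homotopic_refl_iff_of_forall_eq (ℓ₁ := L) (ℓ₂ := W.isFenceOn.horizLoop (J 0).τ₀ hτ₀I hcl₀) fun θ ↦ by
      rw [hL θ, W.isFenceOn.horizLoop_apply hτ₀I hcl₀ θ, W.Φ_base θ]).1 hLnull
  obtain ⟨η₃, hη₃, -, hnulls⟩ := W.isFenceOn.exists_forall_nullLevel_base W.ε_pos (D.box_mem _ (D.mem_P _ (J 0).hv))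
    hstart.1 hstart.2 hnl₀
  set η := min η₁ (min η₂ η₃) with hη
  have hηpos : 0 < η := lt_min hη₁ (lt_min hη₂ hη₃)
  have hη₁' : η ≤ η₁ := min_le_left _ _
  have hη₂' : η ≤ η₂ := (min_le_right _ _).trans (min_le_left _ _)
  have hη₃' : η ≤ η₃ := (min_le_right _ _).trans (min_le_right _ _)
  -- a crossing level on the side `s` within `η`
  have hsymm0 : (J 0).χ₀.symm 0 = (J 0).τ₀ := by rw [← (J 0).χ₀_τ₀, OrderIso.symm_apply_apply]
  have h₃ : ∀ᶠ h in 𝓝 (0 : ℝ), dist ((J 0).χ₀.symm h) (J 0).τ₀ < η := by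
    have hc : ContinuousAt (J 0).χ₀.symm 0 := (J 0).χ₀.symm.continuous.continuousAt
    have := hc.preimage_mem_nhds (ball_mem_nhds ((J 0).χ₀.symm 0) hηpos)
    rw [hsymm0] at this
    exact this
  obtain ⟨ε₀, hε₀, hε₀sub⟩ := Metric.eventually_nhds_iff.1 h₃
  obtain ⟨N, hN⟩ := hcross ε₀ hε₀
  obtain ⟨h, hsh, hhε, hmemK⟩ := hN N le_rfl
  set n := N with hn
  set τ := (J 0).χ₀.symm h with hτdef
  have hχτ : (J 0).χ₀ τ = h := (J 0).χ₀.apply_symm_apply h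
  have hτclose : dist τ (J 0).τ₀ < η := hε₀sub (by rw [dist_zero_right]; exact hhε)
  have hτ : τ ∈ Ioo ((J 0).τ₀ - η) ((J 0).τ₀ + η) := by
    rw [Real.dist_eq, abs_lt] at hτclose; constructor <;> linarith [hτclose.1, hτclose.2]
  have hsτ : 0 < s * (τ - (J 0).τ₀) := by
    rcases hs with rfl | rfl
    · have hh : 0 < h := by linarith
      have : (J 0).χ₀.symm 0 < (J 0).χ₀.symm h := (J 0).χ₀.symm.strictMono hh
      rw [hsymm0] at this; linarith
    · have hh : h < 0 := by linarith
      have : (J 0).χ₀.symm h < (J 0).χ₀.symm 0 := (J 0).χ₀.symm.strictMono hh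
      rw [hsymm0] at this; linarith
  have hyτ : (J 0).Kin.T₁ (J 0).χ₀ τ ∈ F.leaf (K n) := by
    show ProngStar.lift hι ((D.star _ (J 0).hv).pt (J 0).jin ((J 0).β, (J 0).χ₀ τ)) ∈ F.leaf (K n)
    rw [hχτ]; exact hmemK
  have hτ₁ : τ ∈ Ioo ((J 0).τ₀ - η₁) ((J 0).τ₀ + η₁) := ⟨by linarith [hτ.1], by linarith [hτ.2]⟩
  have hτ₃ : τ ∈ Ioo ((J 0).τ₀ - η₃) ((J 0).τ₀ + η₃) := ⟨by linarith [hτ.1], by linarith [hτ.2]⟩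
  have hτW : τ ∈ Ioo ((J 0).τ₀ - W.ε) ((J 0).τ₀ + W.ε) := ⟨by linarith [hτ₁.1], by linarith [hτ₁.2]⟩
  have hτS : τ ∈ sideLevels (J 0).τ₀ s W.ε := ⟨hτW, hsτ.le⟩
  -- the levels between `τ₀` and `τ`
  have hbetween : ∀ u ∈ Icc (0 : ℝ) 1, (J 0).τ₀ + u * (τ - (J 0).τ₀) ∈ Ioo ((J 0).τ₀ - η) ((J 0).τ₀ + η) := by
    intro u hu
    have h1 : |u * (τ - (J 0).τ₀)| ≤ |τ - (J 0).τ₀| := by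
      rw [abs_mul, abs_of_nonneg hu.1]; exact mul_le_of_le_one_left (abs_nonneg _) hu.2
    have h2 : |τ - (J 0).τ₀| < η := abs_sub_lt_iff.2 ⟨by linarith [hτ.2], by linarith [hτ.1]⟩
    constructor <;> [linarith [neg_abs_le (u * (τ - (J 0).τ₀))]; linarith [le_abs_self (u * (τ - (J 0).τ₀))]]
  have hclosed : ∀ u ∈ Icc (0 : ℝ) 1, Ψ 0 ((J 0).τ₀ + u * (τ - (J 0).τ₀)) = Ψ 1 ((J 0).τ₀ + u * (τ - (J 0).τ₀)) := by
    intro u hu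
    set lv := (J 0).τ₀ + u * (τ - (J 0).τ₀) with hlv
    have hlv₁ : lv ∈ Ioo ((J 0).τ₀ - η₁) ((J 0).τ₀ + η₁) :=
      ⟨by linarith [(hbetween u hu).1], by linarith [(hbetween u hu).2]⟩
    have hlvW : lv ∈ Ioo ((J 0).τ₀ - W.ε) ((J 0).τ₀ + W.ε) := ⟨by linarith [hlv₁.1], by linarith [hlv₁.2]⟩
    obtain ⟨h0, h1⟩ := walkPlaneBand_ends ho hℓ hs hturn m hlvW
    rw [hΨ, h0, h1, hχ lv hlv₁]
    have : (D.star (J m).v (J m).hv).pt (J m).jin ((J m).β, (J 0).χ₀ lv) = (D.star (J 0).v (J 0).hv).pt (J 0).jin ((J 0).β, (J 0).χ₀ lv) := by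
      rw [hper]
    exact this.symm
  have havoid : ∀ sg : ℝ, sg = ρ ∨ sg = -ρ → ∀ u ∈ Icc (0 : ℝ) 1, ∀ θ, Ψ θ ((J 0).τ₀ + u * (τ - (J 0).τ₀)) ≠ P.pt sg := by
    intro sg hsg u hu θ
    have hlvS : (J 0).τ₀ + u * (τ - (J 0).τ₀) ∈ sideLevels (J 0).τ₀ s W.ε := mem_sideLevels_of_between hτS hu
    have hlv₂ : dist ((J 0).τ₀ + u * (τ - (J 0).τ₀)) (J 0).τ₀ < η₂ := by
      rw [Real.dist_eq]
      have := hbetween u hu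
      exact abs_sub_lt_iff.2 ⟨by linarith [this.2], by linarith [this.1]⟩
    exact hfar sg hsg (hη₂sub hlv₂ hlvS θ)
  -- the band loop at `τ` winds like the trace about `p±`
  have hwindeq : ∀ sg : ℝ, sg = ρ ∨ sg = -ρ →
      wind (fun t ↦ Ψ (projIcc 0 1 zero_le_one t) τ - P.pt sg) = wind (fun t ↦ traceLoop J ℓ m t - P.pt sg) := by
    intro sg hsg
    rw [hΨ, wind_walkPlaneBand_eq ho hℓ hs hturn m hτS hclosed (havoid sg hsg)]
    exact wind_congr fun t ht ↦ by rw [traceLoop_apply_of_mem hper ht]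
  -- the tracked loop in the compact leaf `K n`, and its image is null (a null level)
  obtain ⟨hΦΨ, hΨc, hΨ0, hΨ1, -, -⟩ := W.track τ hτW hsτ
  have hχτ' : W.χ τ = (J 0).χ₀ τ := hχ τ hτ₁
  have hc1 : W.Ψ 1 τ = W.Ψ 0 τ := by
    rw [hΨ1, hΨ0]
    have : (J m).Kin.T₁ W.χ τ = (J 0).Kin.T₁ W.χ τ := by rw [hper]
    rw [this]
    simp only [ProngBox.T₁, hχτ']
  have hyK : W.Ψ 0 τ ∈ F.leaf (K n) := by rw [hΨ0]; exact hyτ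
  set y := W.Ψ 0 τ with hy
  have hleafy : F.leaf y = F.leaf (K n) := leaf_eq_of_mem hyK
  have hKy : K n ∈ F.leaf y := by rw [hleafy]; exact F.mem_leaf_self _
  haveI : CompactSpace (F.Leaf y) := compactSpace_leaf_of_isCompact (by rw [hleafy]; exact hK n)
  have hmem : ∀ θ, W.Ψ θ τ ∈ F.leaf y := fun θ ↦ F.mem_leaf_of_continuous_toLeafSpace hΨc 0 θ
  set p₀ : F.Leaf y := Leaf.mk y (F.mem_leaf_self y) with hp₀
  have hδc : Continuous fun θ : I ↦ (Leaf.mk (W.Ψ θ τ) (hmem θ) : F.Leaf y) := hΨc.subtype_mk fun θ ↦ hmem θ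
  have h1 : (Leaf.mk (W.Ψ 1 τ) (hmem 1) : F.Leaf y) = p₀ := by
    apply Subtype.ext
    show toLeafSpace (W.Ψ 1 τ) = toLeafSpace (W.Ψ 0 τ)
    rw [hc1]
  set hpath : Path p₀ p₀ :=
    { toFun := fun θ ↦ Leaf.mk (W.Ψ θ τ) (hmem θ)
      continuous_toFun := hδc
      source' := rfl
      target' := h1 } with hhpath
  set Φf : C(F.Leaf y, T.LeafSpace) :=
    ⟨fun q ↦ leafMap F T (g ∘ ι) (q : F.LeafSpace), D.foliated.continuous_leafMap.comp continuous_subtype_val⟩ with hΦf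
  have hval : ∀ θ, Φf (hpath θ) = toLeafSpace (W.Φ θ τ) := fun θ ↦ by
    show toLeafSpace ((g ∘ ι) (ofLeafSpace (toLeafSpace (W.Ψ θ τ)))) = toLeafSpace (W.Φ θ τ)
    rw [hΦΨ θ]
    rfl
  have hclτ : W.Φ 1 τ = W.Φ 0 τ := by rw [hΦΨ 1, hΦΨ 0, hc1]
  obtain ⟨hτ', hcl', hhom⟩ := hnulls τ hτ₃ hclτ
  have hnullh : (hpath.map Φf.continuous).Homotopic (Path.refl _) :=
    (Path.homotopic_refl_iff_of_forall_eq (ℓ₁ := hpath.map Φf.continuous) (ℓ₂ := W.isFenceOn.horizLoop τ hτ' hcl')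
      fun θ ↦ by rw [Path.map_coe, comp_apply, W.isFenceOn.horizLoop_apply hτ' hcl' θ]; exact hval θ).2 hhom
  -- the simple loop of the compact leaf, based at `p₀`, and the degree of the tracked loop
  obtain ⟨β₀, hβ₀c, hβ₀p, hβ₀i, hβ₀s⟩ := exists_leafLoop (x := y) hbi
  obtain ⟨β, hβc, hβp, hβi, hβs, hβ0⟩ := exists_rebase hβ₀c hβ₀p hβ₀i hβ₀s p₀
  set hpath' : Path (β 0) (β 0) := hpath.cast hβ0 hβ0 with hhpath'
  set Φpl : F.Leaf y → ℂ := fun q ↦ ι (Leaf.pt q) with hΦpl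
  have hΦplc : Continuous Φpl := hι.continuous.comp (Leaf.continuous_coe F y)
  have hq : ∀ sg : ℝ, sg = ρ ∨ sg = -ρ → ∀ q : F.Leaf y, Φpl q ≠ P.pt sg := fun sg hsg q ↦
    hp sg hsg n _ (by rw [← hleafy]; exact q.2)
  have hwindh : ∀ sg : ℝ, sg = ρ ∨ sg = -ρ →
      wind (fun t ↦ pathLoop Φpl hpath' t - P.pt sg) = wind (fun t ↦ traceLoop J ℓ m t - P.pt sg) := by
    intro sg hsg
    rw [← hwindeq sg hsg]
    refine congrArg wind (funext fun t ↦ ?_)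
    show ι (W.Ψ (projIcc 0 1 zero_le_one t) τ) - P.pt sg = Ψ (projIcc 0 1 zero_le_one t) τ - P.pt sg
    rw [hΨ, walkPlaneBand_eq_ι ho hℓ hs hturn m hτW hsτ]
  have hjump := P.wind_sub_wind hι he' (continuous_traceLoop ho hℓ hs hturn hper) (periodic_traceLoop m) hρ
  rw [← hwindh (-ρ) (Or.inr rfl), ← hwindh ρ (Or.inl rfl)] at hjump
  have hhom' := CircleLoops.homotopic_loop_or_symm_of_wind' hβc hβp hβi hβs hΦplc hpath' (hq (-ρ) (Or.inr rfl))
    (hq ρ (Or.inl rfl)) hjump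
  -- hence the image of the simple loop is null-homotopic: `K n` is image-null
  have hnullh' : (hpath'.map Φf.continuous).Homotopic (Path.refl _) := by
    have heq : ∀ θ, (hpath'.map Φf.continuous) θ = (hpath.map Φf.continuous) θ := fun θ ↦ rfl
    exact (Path.homotopic_refl_iff_of_forall_eq heq).2 hnullh
  have hloopnull : ((CircleLoops.loop hβc hβp).map Φf.continuous).Homotopic (Path.refl _) := by
    rcases hhom' with hh | hh
    · exact (hh.map Φf).symm.trans hnullh'
    · have h1 : (((CircleLoops.loop hβc hβp).symm).map Φf.continuous).Homotopic (Path.refl _) := (hh.map Φf).symm.trans hnullh'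
      have h2 : ((CircleLoops.loop hβc hβp).symm).map Φf.continuous = ((CircleLoops.loop hβc hβp).map Φf.continuous).symm := rfl
      rw [h2] at h1
      simpa using h1.symm₂
  refine hess n ⟨y, β, hβc, hβp, hKy, hβi, hβs, ?_⟩
  have heq : (F.leafLoop (loopPath β hβc hβp) (continuous_toLeafSpace_loopPath β hβc hβp)).map D.foliated.continuous_leafMap =
      (CircleLoops.loop hβc hβp).map Φf.continuous := by
    ext θ; rfl
  rw [heq]
  exact hloopnull

end StarData

end Literature.Topology.PlanarFoliations
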